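import Summits.QuantumFields.YangMills.Theorems.BalabanUVNodesN22WindowSoftTwoPointDomSys
import Summits.QuantumFields.YangMills.Theorems.BalabanUVNodesN22WindowOfLocalizedSumAtSlots

/-!
# NODE N22 (NE9) — THE SOFT-LOCALIZED ROAD AT W1's ACTIVITY LEVEL, END TO END: W1-19b's letters `WindowedNE9` ∕ `WindowedDecay` at W1-20's
# `localizedSum F S emb` DIRECTLY FROM the activity-level slots `Bound238` ∕ `YoungLipschitz` of the towers, activity holomorphy through complexified
# probe readings, and the minimizer TAILS of the readings' site weights

Cell `pub-ymgap`, Track A (HUMAN RULING D-0062), WIDTH SEAT `dag-n22-w2` (g3) on node n22 = NE9; `--kind proof --supports stmt-QuantumFields-20544 --as helper`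
(K3⁷ `SpineGivenEndpointR13SepCoPH`), COUNT-NEUTRAL; THEOREMS ONLY (0 `def`, 0 `sorry`, standard axioms).  Fifth storey of this seat's soft road
(`…N22WindowSoftTwoPoint` → `…Torus` → `…DomSys` → `…Inhabited` → this) and dag-n22-c g11's successor trigger (t8) «compose J30-v1.1 with w2's capstones»,
which that lane handed to this seat by name (pub-ymgap INBOX l.28269 ∕ l.28294).

WHY.  The third storey's capstones `windowedNE9_localizedSum_of_softSum` ∕ `windowedDecay_localizedSum_of_softSum` (p599486) deliver W1-19b's letters from
Σ-shaped per-`K` bounds `hΔ` of def-B's windowed kernel of the localized sum and K-UNIFORM soft majorants `ha`∕`hb` of the summands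
(`C_E·w·e^{−κ d_{k+1}(X)}·e^{−δ₀ dist(z·,X)}·e^{−δ₀ dist(0·,X)}`).  dag-n22-c's J30 v1.1 (p602155) delivers exactly such Σ-shaped bounds —
`abs_polWindow_localizedSum_sub_le_soft_of_activitySlots` (history DIFFERENCE) and `abs_polWindow_localizedSum_le_soft_of_activitySlots` (VALUE) — with every
TERM-level law already discharged modulo W1's ACTIVITY-level slots: the summand is `16·M(X)·r⁻²·w_X(z·)·w_X(0·)` with `M(X) = 8·e·9·64·K₀(64,8)²·e^{−κ d_{k+1}(X)}·
Σ_i ℓ_i|hist_i − hist′_i|` (Road 1's differenced (2.39)–(2.41) engine under `Bound238` + `YoungLipschitz`), resp. `M(X) = e·9·64·K₀(64,8)²·A·e^{−r₁ d_{k+1}(X)}`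
(S25's parametric Kotecký–Preiss engine under `Bound238`), for complexified probe readings `Φ_X` whose real-linear complexifications `ι_X` carry site weights
`‖ι_X e_{l,t,c}‖ ≤ w_X(t)`.  THIS FILE is the junction: if the site weights carry the MINIMIZER TAILS of [I] p. 282 ∕ (4.35)–(4.37) in the cast torus geometry of
the third storey, `w_{K,k,X}(t) ≤ B₃·e^{−δ₀ distCT(cast t, nearest cube of X)}`, then J30's summands ARE soft majorants with `C_E = 16·c·B₃²∕r²`, uniformly in
`(g, g′, k, μ, ν, z, K)` as soon as the slots' numerals `(A, R, r₁, κ)`, the probe radius `r` and the young-Lipschitz moduli `Λ (k+1) ·` are chosen uniformly — and the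
capstones fire.  RESULT: the two letters from hypotheses that ALL sit at W1's activity level or at the reading (`Φ`, `ι`, weights), nothing at term level.

WHAT.  §1 bookkeeping: `sum_moduli_histPrefix_eq_sum_range` (`Σ_{i : Fin (k+1)} Λ_{k+1,i}|g_i − g′_i| = Σ_{i<k+1} …` at `histPrefix`), the two real-arithmetic
junctions `activitySummand_le_softMajorant` (difference) ∕ `valueSummand_le_softMajorant` (value, rate weakened `r₁ ↦ κ ≤ r₁`); §1b the two letters are MONOTONE
(`windowedNE9_of_le`: rate down, moduli up; `windowedDecay_of_le`: rate down) — so a consumer's letter block need only DOMINATE the engine constants.  §2 ★★★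
`windowedNE9_localizedSum_of_activitySlots` — `WindowedNE9 F (localizedSum F S emb) ρ bV W δ₁ (C_9·Λ)`, `δ₁ = ½min{δ₀, κ(4M)⁻¹}`,
`C_9 = (16·8e·9·64·K₀(64,8)²·B₃²∕r²)·e^{12Mδ₁}·K₀(64,8)·K₁(4,δ₀∕2)`, from: `M = L^{m′}`; for every tower `S K` and level `k` W1's `Bound238 ((S K) k) (Wk K k) (sp K k) A R`
and `YoungLipschitz ((S K) k) (Wk K k) (sp K k) (Λ (k+1) ·) R` on prefix sets `Wk K k ∋ histPrefix g k` (`g ∈ W`); Road 1's numerals ONCE (`0 < A`, `0 ≤ r₁`,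
`2κ₀(64,8) ≤ κ ≤ r₁`, `r₁ + 128 log 162 + 2 ≤ R`, `2A e^{5r₁+1} K₀(64,8)·9·64 ≤ 1`); per `(K, k, X)` a complexified probe reading `Φ K k X : Ec K k → Φ-pairs` on an open
`U K k X ⊇ ball 0 r` (ONE radius `r > 0`) through a real-linear `ι K k X`, EXTENDING `emb K k ∘ exp ρ`, mapping `U K k X` into the admissible space of every polymer
inside `X`, with every activity `z ↦ H(Z; histPrefix g k; Φ K k X z)` (`g ∈ W`, `Z ⊆ X`) holomorphic on `U K k X`; site weights `‖ι K k X e_{l,t,c}‖ ≤ w K k X t`, `w ≥ 0`,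
with the TAILS `w K k X t ≤ B₃ e^{−δ₀ distCT(cast t, X)}`, `δ₀ > 0`, `B₃ ≥ 0`.  ★★★ `windowedDecay_localizedSum_of_activitySlots` — the VALUE letter
`WindowedDecay F (localizedSum F S emb) ρ bV W μ ν δ₁` from `Bound238` + activity holomorphy at ONE history per `g` + the same readings∕weights∕tails (single smallness,
`0 ≤ A`); its constant `C₀ = (16·e·9·64·K₀(64,8)²·A·B₃²∕r²)·e^{12Mδ₁}·K₀(64,8)·K₁(4,δ₀∕2)` is the same for every `g ∈ W`.  The record-level corollaries (letters OF
RECORD under W1-20's `Localizes17OfRecord₁₃`, K3⁷ v5 §2b's raw inputs `h9`∕`hdec`) are the sequel `…N22WindowSoftTwoPointAtRecord`.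

HONEST FRAMING (binding).  Count-neutral COMPOSITION of landed theorems (J30 v1.1 p602155 ∘ this seat's p599486) + real arithmetic; NO estimate of Bałaban's is
proved or asserted.  DISPLAYED (hypotheses), with owners: W1's slots `Bound238` ∕ `YoungLipschitz` AT THE TOWERS OF RECORD on the admissible spaces (node N10 ∕ NODE A;
the differenced slot is NOT PRINTED — Road 1's engine output shape), holomorphy of the ACTIVITIES through the complexified minimizer reading and the reading `Φ` itself
(NODE A; [I] p. 264 «can be extended to an analytic function», [II] p. 15), the site weights' tails (the minimizer's exponential localization, [I] p. 282 ∕ [15] Sect. G —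
N09 ∕ NODE A), Road 1's numerals.  Nothing of the (1.7) terms of record is constructed; N22 is NOT discharged (typed 28∕28 · discharged 5∕27 UNCHANGED); K3⁷ OPEN and
NOT claimed; NE9 is NOT IN PRINT for d = 4; no count claim (the chair's single count line is the only count); one finite 𝕋⁴ programme at fixed ε — R4 closes the
CONDITIONAL rung `BalabanLadder.UV` only; NOTHING about the continuum limit, ℝ⁴, infinite volume, OS axioms, a mass gap or the Clay problem is proved or claimed by
any of this.  References (TYPES only, no cite tags on the Summit side): [I] = Bałaban, CMP 109 (1987) (1.7) p. 261, (1.18) p. 263, (1.20)–(1.21) p. 264, p. 282,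
(4.35)–(4.37) pp. 290–291, (5.10) p. 293; [II] = CMP 116 (1988) (2.13) p. 14, p. 15, (2.38) p. 20, (2.39)–(2.41) p. 21.
-/

noncomputable section

open Filter Topology Metric Set
open scoped BigOperators

namespace YMDAG.N22.WindowSoftTwoPoint

open Literature.MathematicalPhysics.QuantumFieldTheory.Balaban1983to89
open Literature.MathematicalPhysics.QuantumFieldTheory.Balaban1983to89.T4Continuum (T4Family)
open Literature.MathematicalPhysics.QuantumFieldTheory.Balaban1983to89.Node00 (TermFamily1 polWindow siteOfInt)
open Literature.MathematicalPhysics.QuantumFieldTheory.Balaban1983to89.Node00.Sect2 (domCount domSys CPair)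
open Literature.MathematicalPhysics.QuantumFieldTheory.Balaban1983to89.Node00.LocalizedSum17 (localizedSum ReadingMaps)
open Literature.MathematicalPhysics.QuantumFieldTheory.Balaban1983to89.Node00.W1 (ClusterTower ClusterStep)
open Literature.MathematicalPhysics.QuantumFieldTheory.Balaban1983to89.Node00.U3OfKernels (histPrefix histPrefix_apply)
open Literature.MathematicalPhysics.QuantumFieldTheory.Balaban1983to89.Node00.U3KernelLetters (WindowedNE9 WindowedDecay)
open Literature.MathematicalPhysics.QuantumFieldTheory.Balaban1983to89.B12Decay510 (delta1)
open Literature.MathematicalPhysics.QuantumFieldTheory.Balaban1983to89.B12Decay510Window (K₁)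
open Literature.MathematicalPhysics.QuantumFieldTheory.Balaban1983to89.B12Decay510Torus (distCT nearT)
open Literature.MathematicalPhysics.QuantumFieldTheory.Balaban1983to89.B12TreeDecay (K₀ kappa₀ K₀_pos)
open Literature.MathematicalPhysics.QuantumFieldTheory.Balaban1983to89.TreeLengthTorus (TPt torusTreeLen torusTreeLen_nonneg)
open Literature.MathematicalPhysics.QuantumFieldTheory.Balaban1983to89.B12Sec2to5 (l1 l1_nonneg)
open YMDAG.N22.WindowOfLocalTerms (abs_polWindow_localizedSum_sub_le_soft_of_activitySlots abs_polWindow_localizedSum_le_soft_of_activitySlots)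

/-! ## §1 Bookkeeping: the history modulus at `histPrefix`, and the two real-arithmetic junctions «J30 summand ≤ soft majorant» -/

/-- At the cut histories `histPrefix g k`, `histPrefix g′ k` the young-Lipschitz modulus `Σ_{i : Fin (k+1)} Λ_{k+1,i}|hist_i − hist′_i|` of J30's summand IS the
letter's modulus `Σ_{i<k+1} Λ_{k+1,i}|g_i − g′_i|` (`histPrefix_apply` + `Finset.sum_range`). -/
theorem sum_moduli_histPrefix_eq_sum_range (Λ : ℕ → ℕ → ℝ) (g g' : ℕ → ℝ) (k : ℕ) :
    ∑ i : Fin (k + 1), Λ (k + 1) i * |histPrefix g k i - histPrefix g' k i| = ∑ i ∈ Finset.range (k + 1), Λ (k + 1) i * |g i - g' i| := by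
  simp only [histPrefix_apply]
  exact (Finset.sum_range fun i => Λ (k + 1) i * |g i - g' i|).symm

/-- **DIFFERENCE JUNCTION** (real arithmetic): J30's summand `16·((e^{−κd}·c)·L)∕r²·(w_z·w_0)` with site weights under the tails `w_z ≤ B₃e_z`, `w_0 ≤ B₃e_0`
is at most the soft majorant `(16cB₃²∕r²)·L′·e^{−κd}·e_z·e_0` (`L = L′` the history modulus in its two spellings). -/
theorem activitySummand_le_softMajorant {c L L' r wz w0 B₃ ez e0 κ d : ℝ} (hc : 0 ≤ c) (hL : 0 ≤ L) (hLL : L = L') (hr : 0 < r) (hB₃ : 0 ≤ B₃)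
    (hw0 : 0 ≤ w0) (hez : 0 ≤ ez) (hz : wz ≤ B₃ * ez) (h0 : w0 ≤ B₃ * e0) :
    16 * ((Real.exp (-(κ * d)) * c) * L) / r ^ 2 * (wz * w0) ≤ (16 * c * B₃ ^ 2 / r ^ 2) * L' * Real.exp (-κ * d) * ez * e0 := by
  subst hLL
  have h2 : wz * w0 ≤ (B₃ * ez) * (B₃ * e0) := mul_le_mul hz h0 hw0 (mul_nonneg hB₃ hez)
  have h3 : 0 ≤ 16 * ((Real.exp (-(κ * d)) * c) * L) / r ^ 2 := by positivity
  calc 16 * ((Real.exp (-(κ * d)) * c) * L) / r ^ 2 * (wz * w0)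
      ≤ 16 * ((Real.exp (-(κ * d)) * c) * L) / r ^ 2 * ((B₃ * ez) * (B₃ * e0)) := mul_le_mul_of_nonneg_left h2 h3
    _ = (16 * c * B₃ ^ 2 / r ^ 2) * L * Real.exp (-κ * d) * ez * e0 := by rw [neg_mul]; ring

/-- **VALUE JUNCTION** (real arithmetic): J30 v1.1's value summand `16·(c·A·e^{−r₁d})∕r²·(w_z·w_0)` under the tails is at most the soft majorant
`(16cAB₃²∕r²)·1·e^{−κd}·e_z·e_0` for any `κ ≤ r₁` (`d ≥ 0`). -/
theorem valueSummand_le_softMajorant {c A r wz w0 B₃ ez e0 κ r₁ d : ℝ} (hc : 0 ≤ c) (hA : 0 ≤ A) (hr : 0 < r) (hB₃ : 0 ≤ B₃)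
    (hw0 : 0 ≤ w0) (hez : 0 ≤ ez) (he0 : 0 ≤ e0) (hz : wz ≤ B₃ * ez) (h0 : w0 ≤ B₃ * e0) (hκ : κ ≤ r₁) (hd : 0 ≤ d) :
    16 * (c * A * Real.exp (-(r₁ * d))) / r ^ 2 * (wz * w0) ≤ (16 * c * A * B₃ ^ 2 / r ^ 2) * 1 * Real.exp (-κ * d) * ez * e0 := by
  have h2 : wz * w0 ≤ (B₃ * ez) * (B₃ * e0) := mul_le_mul hz h0 hw0 (mul_nonneg hB₃ hez)
  have hexp : Real.exp (-(r₁ * d)) ≤ Real.exp (-κ * d) := by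
    rw [neg_mul]
    exact Real.exp_le_exp.2 (neg_le_neg (mul_le_mul_of_nonneg_right hκ hd))
  have h3 : 0 ≤ 16 * (c * A * Real.exp (-(r₁ * d))) / r ^ 2 := by positivity
  have h4 : 0 ≤ 16 * (c * A) / r ^ 2 * ((B₃ * ez) * (B₃ * e0)) := by positivity
  calc 16 * (c * A * Real.exp (-(r₁ * d))) / r ^ 2 * (wz * w0)
      ≤ 16 * (c * A * Real.exp (-(r₁ * d))) / r ^ 2 * ((B₃ * ez) * (B₃ * e0)) := mul_le_mul_of_nonneg_left h2 h3
    _ = 16 * (c * A) / r ^ 2 * ((B₃ * ez) * (B₃ * e0)) * Real.exp (-(r₁ * d)) := by ring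
    _ ≤ 16 * (c * A) / r ^ 2 * ((B₃ * ez) * (B₃ * e0)) * Real.exp (-κ * d) := mul_le_mul_of_nonneg_left hexp h4
    _ = (16 * c * A * B₃ ^ 2 / r ^ 2) * 1 * Real.exp (-κ * d) * ez * e0 := by ring

/-! ## §1b The two letters are monotone in their constants (rate down, moduli up) -/

section Monotone

variable (F : T4Family) {𝔄 : Type*} [NormedRing 𝔄] [NormedAlgebra ℝ 𝔄] {V : Type*} [NormedAddCommGroup V] [NormedSpace ℝ V] {ι' : Type*} [Fintype ι']
  (ℰ : TermFamily1 F 𝔄) (ρ : V →L[ℝ] 𝔄) (bV : Module.Basis ι' ℝ V)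

/-- **`WindowedNE9` IS MONOTONE**: a windowed joint history-Lipschitz bound at rate `κ` and moduli `Λ` implies the one at any smaller rate `κ′ ≤ κ` and any larger
non-negative moduli `Λ ≤ Λ′` (`|z|₁ ≥ 0`, `Finset.sum_le_sum`) — so K3⁷'s letter block `ℓ` need only DOMINATE the engine's constants (`ℓ.κ ≤ δ₁`, `C_9·Λ ≤ ℓ.moduli`). -/
theorem windowedNE9_of_le {W : Set (ℕ → ℝ)} {κ κ' : ℝ} {Λ Λ' : ℕ → ℕ → ℝ} (h : WindowedNE9 F ℰ ρ bV W κ Λ) (hκ : κ' ≤ κ)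
    (hΛ : ∀ k i, Λ k i ≤ Λ' k i) (hΛ' : ∀ k i, 0 ≤ Λ' k i) : WindowedNE9 F ℰ ρ bV W κ' Λ' := by
  intro g hg g' hg' k μ ν z
  filter_upwards [h g hg g' hg' k μ ν z] with K hK
  refine hK.trans ?_
  have hS : ∑ i ∈ Finset.range (k + 1), Λ (k + 1) i * |g i - g' i| ≤ ∑ i ∈ Finset.range (k + 1), Λ' (k + 1) i * |g i - g' i| :=
    Finset.sum_le_sum fun i _ => mul_le_mul_of_nonneg_right (hΛ _ _) (abs_nonneg _)
  have hS' : 0 ≤ ∑ i ∈ Finset.range (k + 1), Λ' (k + 1) i * |g i - g' i| := Finset.sum_nonneg fun i _ => mul_nonneg (hΛ' _ _) (abs_nonneg _)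
  have hexp : Real.exp (-(κ * l1 z)) ≤ Real.exp (-(κ' * l1 z)) :=
    Real.exp_le_exp.2 (neg_le_neg (mul_le_mul_of_nonneg_right hκ (l1_nonneg z)))
  exact (mul_le_mul_of_nonneg_left hS (Real.exp_nonneg _)).trans (mul_le_mul_of_nonneg_right hexp hS')

/-- **`WindowedDecay` IS MONOTONE IN THE RATE**: windowed (5.10) decay at rate `κ` implies it at any `κ′ ≤ κ` (constant `max C₀ 0`). -/
theorem windowedDecay_of_le {W : Set (ℕ → ℝ)} {μ ν : Fin 4} {κ κ' : ℝ} (h : WindowedDecay F ℰ ρ bV W μ ν κ) (hκ : κ' ≤ κ) :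
    WindowedDecay F ℰ ρ bV W μ ν κ' := by
  intro g hg
  obtain ⟨C₀, hC⟩ := h g hg
  refine ⟨max C₀ 0, fun k z => ?_⟩
  filter_upwards [hC k z] with K hK
  refine hK.trans ?_
  calc C₀ * Real.exp (-κ * l1 z) ≤ max C₀ 0 * Real.exp (-κ * l1 z) := mul_le_mul_of_nonneg_right (le_max_left _ _) (Real.exp_nonneg _)
    _ ≤ max C₀ 0 * Real.exp (-κ' * l1 z) :=
        mul_le_mul_of_nonneg_left (Real.exp_le_exp.2 (mul_le_mul_of_nonneg_right (neg_le_neg hκ) (l1_nonneg z))) (le_max_right _ _)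

end Monotone

/-! ## §2 CAPSTONES AT ACTIVITY LEVEL: the letters `WindowedNE9` ∕ `WindowedDecay` at `localizedSum F S emb` from W1's slots + complexified readings + tails -/

variable (F : T4Family)
variable {𝔸 : Type*} [NormedRing 𝔸] [NormedAlgebra ℝ 𝔸] {V : Type*} [NormedAddCommGroup V] [NormedSpace ℝ V] {ι' : Type*} [Fintype ι']

open Classical in
/-- ★★★ **THE SOFT ROAD AT ACTIVITY LEVEL, END TO END — HISTORY-LIPSCHITZ LETTER.**  For node00-def-W1's term family `localizedSum F S emb` (W1-20; probe fields valued
in the configuration algebra `𝔸`, read through `emb`), a window `W` of coupling sequences, cube side `M = L^{m′}`: IF at every tower `S K` and level `k` W1's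
activity-level slots `Bound238 ((S K) k) (Wk K k) (sp K k) A R` and `YoungLipschitz ((S K) k) (Wk K k) (sp K k) (Λ (k+1) ·) R` hold on prefix sets containing the cut
histories of `W` ([II] Lemma 3 (2.38) and its differenced form — DISPLAYED), with Road 1's numerals chosen ONCE; IF per `(K, k, X)` a complexified probe reading
`Φ K k X` on an open `U K k X ⊇ ball 0 r` through a real-linear complexification `ι K k X` of the probe fields EXTENDS the reading of the exponential chart
(`Φ (ι B) = emb K k (exp ρB)`), maps `U K k X` into the admissible space of every polymer inside `X`, and makes every activity `z ↦ H(Z; histPrefix g k; Φ K k X z)`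
(`g ∈ W`, `Z ⊆ X`) holomorphic ([I] p. 264 ∕ [II] p. 15 — DISPLAYED); IF the complexifications' site weights `‖ι K k X e_{l,t,c}‖ ≤ w K k X t` carry the minimizer TAILS
`w K k X t ≤ B₃ e^{−δ₀ distCT(cast t, X)}` ([I] p. 282 — DISPLAYED), `δ₀ > 0`, and `2κ₀(64,8) ≤ κ ≤ r₁`: THEN W1-19b's binder
`WindowedNE9 F (localizedSum F S emb) ρ bV W δ₁ (C_9·Λ)` holds, `δ₁ = ½min{δ₀, κ(4M)⁻¹}`, `C_9 = (16·8e·9·64·K₀(64,8)²·B₃²∕r²)·e^{12Mδ₁}K₀(64,8)K₁(4,δ₀∕2)` —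
dag-n22-c's J30 v1.1 `abs_polWindow_localizedSum_sub_le_soft_of_activitySlots` composed with this seat's `windowedNE9_localizedSum_of_softSum`; the `hK` input of
dag-n22-w3's (1.21) passage `AtKernels.ne9_EA_of_windowed` now reads ACTIVITY-level hypotheses only. -/
theorem windowedNE9_localizedSum_of_activitySlots (m' : ℕ) (M : ℕ) [NeZero M] (hM : M = F.L ^ m')
    (S : (K : ℕ) → ClusterTower (F.P K) 𝔸 M) (emb : ReadingMaps F 𝔸 𝔸) (ρ : V →L[ℝ] 𝔸) (bV : Module.Basis ι' ℝ V) (W : Set (ℕ → ℝ))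
    (Wk : (K k : ℕ) → Set (Fin (k + 1) → ℝ)) (hWk : ∀ g ∈ W, ∀ K k, histPrefix g k ∈ Wk K k)
    (sp : (K k : ℕ) → (domSys (F.P K) M (k + 1)).Dom → Set (CPair (F.P K) 𝔸))
    {A R r₁ κ δ₀ B₃ r : ℝ} (Λ : ℕ → ℕ → ℝ)
    (hA : 0 < A) (hr₁ : 0 ≤ r₁) (hκ : κ ≤ r₁) (hκ₀ : kappa₀ (4 * 2 ^ 4) (2 * 4) ≤ κ / 2) (hrate : r₁ + 2 * (64 * Real.log 162) + 2 ≤ R)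
    (hsmall : 2 * A * Real.exp (5 * r₁ + 1) * K₀ 64 8 * 9 * 64 ≤ 1) (hΛ : ∀ k i, 0 ≤ Λ k i) (hδ₀ : 0 < δ₀) (hB₃ : 0 ≤ B₃) (hr : 0 < r)
    (h238 : ∀ K k, ((S K) k).Bound238 (Wk K k) (sp K k) A R)
    (hYL : ∀ K k, ((S K) k).YoungLipschitz (Wk K k) (sp K k) (fun i : Fin (k + 1) => Λ (k + 1) i) R)
    (Ec : ℕ → ℕ → Type*) [∀ K k, NormedAddCommGroup (Ec K k)] [∀ K k, NormedSpace ℂ (Ec K k)]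
    (ι : (K k : ℕ) → (domSys (F.P K) M (k + 1)).Dom → ((Fin (F.P K).d → Site (F.P K) (k + 1) → V) →L[ℝ] Ec K k))
    (Φ : (K k : ℕ) → (domSys (F.P K) M (k + 1)).Dom → Ec K k → CPair (F.P K) 𝔸)
    (U : (K k : ℕ) → (domSys (F.P K) M (k + 1)).Dom → Set (Ec K k)) (hU : ∀ K k X, IsOpen (U K k X)) (hrU : ∀ K k X, ball (0 : Ec K k) r ⊆ U K k X)
    (hHhol : ∀ g ∈ W, ∀ (K k : ℕ) (X Z : (domSys (F.P K) M (k + 1)).Dom), Z.1 ⊆ X.1 →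
      DifferentiableOn ℂ (fun z => ((S K) k).H (histPrefix g k) (Φ K k X z) Z) (U K k X))
    (hΦemb : ∀ (K k : ℕ) (X : (domSys (F.P K) M (k + 1)).Dom) (B : Fin (F.P K).d → Site (F.P K) (k + 1) → V),
      Φ K k X (ι K k X B) = emb K k (fun l t => NormedSpace.exp (ρ (B l t))))
    (hΦsp : ∀ (K k : ℕ) (X : (domSys (F.P K) M (k + 1)).Dom), ∀ z ∈ U K k X, ∀ Z : (domSys (F.P K) M (k + 1)).Dom, Z.1 ⊆ X.1 → Φ K k X z ∈ sp K k Z)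
    (w : (K k : ℕ) → (domSys (F.P K) M (k + 1)).Dom → Site (F.P K) (k + 1) → ℝ) (hw₀ : ∀ K k X t, 0 ≤ w K k X t)
    (hw : ∀ (K k : ℕ) (X : (domSys (F.P K) M (k + 1)).Dom) (l : Fin (F.P K).d) (t : Site (F.P K) (k + 1)) (c : ι'),
      ‖ι K k X (Pi.single l (Pi.single t (bV c)))‖ ≤ w K k X t)
    (htail : ∀ (K k : ℕ) (X : (domSys (F.P K) M (k + 1)).Dom) (t : Site (F.P K) (k + 1)),
      let e : Site (F.P K) (k + 1) → TPt 4 (domCount (F.P K) M (k + 1) * M) := fun x i => (ZMod.cast (x i) : ZMod (domCount (F.P K) M (k + 1) * M))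
      w K k X t ≤ B₃ * Real.exp (-δ₀ * distCT (domCount (F.P K) M (k + 1)) M (e t) (nearT (M := M) (e t) X))) :
    WindowedNE9 F (localizedSum F S emb) ρ bV W (delta1 δ₀ κ ((M : ℝ) * 4))
      (fun k i => (16 * (8 * (Real.exp 1 * 9 * 64 * K₀ 64 8 ^ 2)) * B₃ ^ 2 / r ^ 2) *
        Real.exp (delta1 δ₀ κ ((M : ℝ) * 4) * ((M : ℝ) * 4) * 3) * K₀ (4 * 2 ^ 4) (2 * 4) * K₁ 4 (δ₀ / 2) * Λ k i) := by
  have hc : (0 : ℝ) ≤ 8 * (Real.exp 1 * 9 * 64 * K₀ 64 8 ^ 2) := by have := K₀_pos 64 8; positivity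
  have hCE : (0 : ℝ) ≤ 16 * (8 * (Real.exp 1 * 9 * 64 * K₀ 64 8 ^ 2)) * B₃ ^ 2 / r ^ 2 := by positivity
  refine windowedNE9_localizedSum_of_softSum F m' M hM S emb ρ bV W Λ hΛ hCE hδ₀ hκ₀
    (fun g g' k μ ν z K X => 16 * ((Real.exp (-(κ * torusTreeLen X.1)) * (8 * (Real.exp 1 * 9 * 64 * K₀ 64 8 ^ 2))) *
        ∑ i : Fin (k + 1), Λ (k + 1) i * |histPrefix g k i - histPrefix g' k i|) / r ^ 2 *
          (w K k X (siteOfInt F K (k + 1) z) * w K k X (siteOfInt F K (k + 1) 0)))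
    (fun g hg g' hg' k μ ν z K => ?_) (fun g hg g' hg' k μ ν z K X => ?_)
  · exact abs_polWindow_localizedSum_sub_le_soft_of_activitySlots F S emb ρ bV k K (Wk K k) (sp K k) (fun i : Fin (k + 1) => Λ (k + 1) i)
      hA hr₁ hκ hrate hsmall (fun i => hΛ _ _) (h238 K k) (hYL K k) (hWk g hg K k) (hWk g' hg' K k) (ι K k) (Φ K k) (U K k) (hU K k) hr (hrU K k)
      (hHhol g hg K k) (hHhol g' hg' K k) (hΦemb K k) (hΦsp K k) (w K k) (hw₀ K k) (hw K k) μ ν z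
  · exact activitySummand_le_softMajorant hc (Finset.sum_nonneg fun i _ => mul_nonneg (hΛ _ _) (abs_nonneg _))
      (sum_moduli_histPrefix_eq_sum_range Λ g g' k) hr hB₃ (hw₀ K k X _) (Real.exp_nonneg _) (htail K k X _) (htail K k X _)

open Classical in
/-- ★★★ **THE SOFT ROAD AT ACTIVITY LEVEL, END TO END — VALUE LETTER.**  Same objects; IF at every tower and level W1's `Bound238 ((S K) k) (Wk K k) (sp K k) A R` holds
(`0 ≤ A`, Road 1's single smallness `A e^{5r₁+1}K₀(64,8)·9·64 ≤ 1`, `r₁ + 128 log 162 + 2 ≤ R`, `2κ₀(64,8) ≤ κ ≤ r₁`), the complexified readings `Φ K k X` on open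
`U K k X ⊇ ball 0 r` extend `emb K k ∘ exp ρ`, map into the spaces and make every activity `z ↦ H(Z; histPrefix g k; Φ K k X z)` holomorphic (`g ∈ W`, `Z ⊆ X`), and the
site weights of the complexifications carry the tails `w K k X t ≤ B₃e^{−δ₀ distCT(cast t, X)}`: THEN W1-19b's VALUE binder `WindowedDecay F (localizedSum F S emb) ρ bV W μ ν δ₁`
holds (`δ₁ = ½min{δ₀, κ(4M)⁻¹}`), with ONE constant `C₀ = (16·e·9·64·K₀(64,8)²·A·B₃²∕r²)·e^{12Mδ₁}K₀(64,8)K₁(4,δ₀∕2)` for every `g ∈ W` — J30 v1.1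
`abs_polWindow_localizedSum_le_soft_of_activitySlots` composed with this seat's `windowedDecay_localizedSum_of_softSum`; the windowed (5.10) input of the (D4) road
(`AtKernels.kernelDecay_of_windowed`) in ACTIVITY currency. -/
theorem windowedDecay_localizedSum_of_activitySlots (m' : ℕ) (M : ℕ) [NeZero M] (hM : M = F.L ^ m')
    (S : (K : ℕ) → ClusterTower (F.P K) 𝔸 M) (emb : ReadingMaps F 𝔸 𝔸) (ρ : V →L[ℝ] 𝔸) (bV : Module.Basis ι' ℝ V) (W : Set (ℕ → ℝ))
    (Wk : (K k : ℕ) → Set (Fin (k + 1) → ℝ)) (hWk : ∀ g ∈ W, ∀ K k, histPrefix g k ∈ Wk K k)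
    (sp : (K k : ℕ) → (domSys (F.P K) M (k + 1)).Dom → Set (CPair (F.P K) 𝔸))
    {A R r₁ κ δ₀ B₃ r : ℝ}
    (hA : 0 ≤ A) (hr₁ : 0 ≤ r₁) (hκ : κ ≤ r₁) (hκ₀ : kappa₀ (4 * 2 ^ 4) (2 * 4) ≤ κ / 2) (hrate : r₁ + 2 * (64 * Real.log 162) + 2 ≤ R)
    (hsmall : A * Real.exp (5 * r₁ + 1) * K₀ 64 8 * 9 * 64 ≤ 1) (hδ₀ : 0 < δ₀) (hB₃ : 0 ≤ B₃) (hr : 0 < r)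
    (h238 : ∀ K k, ((S K) k).Bound238 (Wk K k) (sp K k) A R)
    (Ec : ℕ → ℕ → Type*) [∀ K k, NormedAddCommGroup (Ec K k)] [∀ K k, NormedSpace ℂ (Ec K k)]
    (ι : (K k : ℕ) → (domSys (F.P K) M (k + 1)).Dom → ((Fin (F.P K).d → Site (F.P K) (k + 1) → V) →L[ℝ] Ec K k))
    (Φ : (K k : ℕ) → (domSys (F.P K) M (k + 1)).Dom → Ec K k → CPair (F.P K) 𝔸)
    (U : (K k : ℕ) → (domSys (F.P K) M (k + 1)).Dom → Set (Ec K k)) (hU : ∀ K k X, IsOpen (U K k X)) (hrU : ∀ K k X, ball (0 : Ec K k) r ⊆ U K k X)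
    (hHhol : ∀ g ∈ W, ∀ (K k : ℕ) (X Z : (domSys (F.P K) M (k + 1)).Dom), Z.1 ⊆ X.1 →
      DifferentiableOn ℂ (fun z => ((S K) k).H (histPrefix g k) (Φ K k X z) Z) (U K k X))
    (hΦemb : ∀ (K k : ℕ) (X : (domSys (F.P K) M (k + 1)).Dom) (B : Fin (F.P K).d → Site (F.P K) (k + 1) → V),
      Φ K k X (ι K k X B) = emb K k (fun l t => NormedSpace.exp (ρ (B l t))))
    (hΦsp : ∀ (K k : ℕ) (X : (domSys (F.P K) M (k + 1)).Dom), ∀ z ∈ U K k X, ∀ Z : (domSys (F.P K) M (k + 1)).Dom, Z.1 ⊆ X.1 → Φ K k X z ∈ sp K k Z)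
    (w : (K k : ℕ) → (domSys (F.P K) M (k + 1)).Dom → Site (F.P K) (k + 1) → ℝ) (hw₀ : ∀ K k X t, 0 ≤ w K k X t)
    (hw : ∀ (K k : ℕ) (X : (domSys (F.P K) M (k + 1)).Dom) (l : Fin (F.P K).d) (t : Site (F.P K) (k + 1)) (c : ι'),
      ‖ι K k X (Pi.single l (Pi.single t (bV c)))‖ ≤ w K k X t)
    (htail : ∀ (K k : ℕ) (X : (domSys (F.P K) M (k + 1)).Dom) (t : Site (F.P K) (k + 1)),
      let e : Site (F.P K) (k + 1) → TPt 4 (domCount (F.P K) M (k + 1) * M) := fun x i => (ZMod.cast (x i) : ZMod (domCount (F.P K) M (k + 1) * M))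
      w K k X t ≤ B₃ * Real.exp (-δ₀ * distCT (domCount (F.P K) M (k + 1)) M (e t) (nearT (M := M) (e t) X)))
    (μ ν : Fin 4) :
    WindowedDecay F (localizedSum F S emb) ρ bV W μ ν (delta1 δ₀ κ ((M : ℝ) * 4)) := by
  have hc : (0 : ℝ) ≤ Real.exp 1 * 9 * 64 * K₀ 64 8 ^ 2 := by have := K₀_pos 64 8; positivity
  have hCE : (0 : ℝ) ≤ 16 * (Real.exp 1 * 9 * 64 * K₀ 64 8 ^ 2) * A * B₃ ^ 2 / r ^ 2 := by positivity
  refine windowedDecay_localizedSum_of_softSum F m' M hM S emb ρ bV W hCE zero_le_one hδ₀ hκ₀ μ ν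
    (fun g k z K X => 16 * (Real.exp 1 * 9 * 64 * K₀ 64 8 ^ 2 * A * Real.exp (-(r₁ * torusTreeLen X.1))) / r ^ 2 *
      (w K k X (siteOfInt F K (k + 1) z) * w K k X (siteOfInt F K (k + 1) 0)))
    (fun g hg k z K => ?_) (fun g hg k z K X => ?_)
  · exact abs_polWindow_localizedSum_le_soft_of_activitySlots F S emb ρ bV k K (Wk K k) (sp K k) hA hr₁ hrate hsmall (h238 K k) (hWk g hg K k)
      (ι K k) (Φ K k) (U K k) (hU K k) hr (hrU K k) (hHhol g hg K k) (hΦemb K k) (hΦsp K k) (w K k) (hw₀ K k) (hw K k) μ ν z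
  · exact valueSummand_le_softMajorant hc hA hr hB₃ (hw₀ K k X _) (Real.exp_nonneg _) (Real.exp_nonneg _) (htail K k X _) (htail K k X _) hκ
      (torusTreeLen_nonneg _)

end YMDAG.N22.WindowSoftTwoPoint

end
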